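import Mathlib
import Summits.ResolutionOfSingularities.ResolutionOfSingularities.Theorems.WeightedInvariantLocalWeightedDropNCResBadDirB
import Summits.ResolutionOfSingularities.ResolutionOfSingularities.Theorems.WeightedInvariantLocalWeightedDropNCResSettingStart

/-!
# `WeightedInvariant.LocalWeightedDrop` ENGINE, W′|₄ line — D₃ᴮ object (7): THE `o ≤ 1` ENDGAME IN B-FORM REDUCED TO ITS TANGENT CASE (HAND D, reduction)

Sub-problem `ResolutionOfSingularities`, ENGINE crux `stmt-ResolutionOfSingularities-8899` (`LocalWeightedDrop`), registered stub W′|₄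
`stub_wildWideApexFourStartsWon`; res-L1-w43-plan-1 RULING 2026-08-27T21:45:42Z (D₃ᴮ lane) — the hypothesis `hend` of `surfaceBoundaryNC_of_regimesB`.
[OURS · L1 W4.3 · chain w43 · res-L1-w43-lead-1 g6; def-free; uses res-L1-w43-stub-1's normal-crossing recognitions (T0) `germIsNC_of_admissible_of_o_eq_zero`
and (T1) `germIsNC_of_admissible_of_linear_free_letter` (…NCResSettingStart), which cost NO move.  Nothing here is a statement of any manuscript;
AI-produced, gate-checked, weaker than expert review.]

WHAT REMAINS OF THE ENDGAME (`hT`, the TANGENT CASE): `ord f = 1` and EVERY linear coefficient of `f` at a letter outside the boundary vanishes — the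
regular surface `X = V(f)` is tangent to the boundary flag at the point (its tangent plane is spanned by boundary conormals).  This residual is NOT a
re-thread of R8 (`NCTransport.exists_winsIn_orderOne_mul_prod`, a bare-game win whose graph re-coordinatisations `x_a ↦ x_a + η` of a BOUNDARY letter
`a` are not B-permissible): with `f = x_a·u − g(x_b, x_c)` the tangency locus `X ∩ H_a = V(g) ⊂ H_a` is an arbitrary plane curve germ, so the tangent
case contains the B-permissible embedded resolution of plane curve germs with boundary (point blow-ups) followed by curve blow-ups along the
tangency curves (contact induction).  It is recorded here as the ONE hypothesis `hT` — in every dimension `m + 1` for the reduction, at `m = 2` for D₃ᴮ.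

* `endPhaseB_of_tangent` — `hend` of `surfaceBoundaryNC_of_regimesB` from the tangent case alone (any `m`, any field);
* **`surfaceBoundaryNC_of_apexColumnB_of_tangentB`** — D₃ᴮ (B-forced normal crossing from EVERY admissibly decorated position, three letters,
  `k` algebraically closed of characteristic `p`) MODULO the apex-column regime `hH` (hand B) and the tangent endgame `hT` (hand D) only.
-/

set_option linter.dupNamespace false -- mandated namespace of this single-conjunct summit

noncomputable section

namespace Summit.ResolutionOfSingularities.ResolutionOfSingularities.Theorems

namespace TameFourTupleDrop

open MvPowerSeries Literature.AlgebraicGeometry.Resolution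

variable {k : Type} [Field k] {m : ℕ}

/-- In the `o = 1` phase the equation has no constant term. -/
theorem Decoration.constantCoeff_f_eq_zero_of_o_ne_zero (δ : Decoration k m) (ho : δ.o ≠ 0) : constantCoeff δ.f = 0 := by
  by_contra hne
  apply ho
  have h0 : δ.f.order = 0 := by
    by_contra h
    exact hne (order_ne_zero_iff_constCoeff_eq_zero.mp h)
  rw [Decoration.o, h0, ENat.toNat_zero]

/-- **THE `o ≤ 1` ENDGAME IN B-FORM FROM ITS TANGENT CASE** (every dimension, every field): the normal-crossing recognitions (T0) (`ord f = 0`) and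
(T1) (a non-zero linear coefficient of `f` at a letter outside the boundary) cost no move; what remains is the tangent case `hT`. -/
theorem endPhaseB_of_tangent
    (hT : ∀ (b : MvPowerSeries (Fin (m + 1)) k) (δ : Decoration k m), Admissible b δ → δ.o = 1 →
      (∀ j, j ∉ δ.E → coeff (Finsupp.single j 1) δ.f = 0) →
      DBWinsTo (fun τ => GermIsNC τ.1 ∨ (Admissible τ.1 τ.2 ∧ τ.2.head < δ.head)) (b, δ))
    (b : MvPowerSeries (Fin (m + 1)) k) (δ : Decoration k m) (hadm : Admissible b δ) (ho : δ.o ≤ 1) :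
    DBWinsTo (fun τ : MvPowerSeries (Fin (m + 1)) k × Decoration k m => GermIsNC τ.1 ∨ (Admissible τ.1 τ.2 ∧ τ.2.head < δ.head)) (b, δ) := by
  rcases Nat.lt_or_ge δ.o 1 with h0 | h1
  · exact DBWinsTo.of_target (Or.inl (germIsNC_of_admissible_of_o_eq_zero hadm (by omega)))
  · have ho1 : δ.o = 1 := le_antisymm ho h1
    have hf0 : constantCoeff δ.f = 0 := δ.constantCoeff_f_eq_zero_of_o_ne_zero (by omega)
    by_cases hfree : ∃ j, j ∉ δ.E ∧ coeff (Finsupp.single j 1) δ.f ≠ 0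
    · obtain ⟨j, hj, hc⟩ := hfree
      exact DBWinsTo.of_target (Or.inl (germIsNC_of_admissible_of_linear_free_letter hadm hj hf0 hc))
    · push Not at hfree
      exact hT b δ hadm ho1 (fun j hj => by simpa using hfree j hj)

/-- **D₃ᴮ MODULO THE APEX-COLUMN REGIME AND THE TANGENT ENDGAME** (three letters, `k` algebraically closed of characteristic `p`): with regimes (P), (L),
(B) tree theorems in B-form (`regimePresentedB`, `regimeLetterB`, `regimeBadB`) and the endgame reduced to its tangent case, a B-forced normal crossing from
EVERY admissibly decorated position needs only `hH` (hand B) and `hT` (hand D). -/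
theorem surfaceBoundaryNC_of_apexColumnB_of_tangentB (p : ℕ) [Fact p.Prime] [CharP k p] [IsAlgClosed k]
    (hH : ∀ (b : MvPowerSeries (Fin (2 + 1)) k) (δ : Decoration k 2), Admissible b δ → 2 ≤ δ.o → δ.HCol →
      DBWinsTo (fun τ => Admissible τ.1 τ.2 ∧ τ.2.head < δ.head) (b, δ))
    (hT : ∀ (b : MvPowerSeries (Fin (2 + 1)) k) (δ : Decoration k 2), Admissible b δ → δ.o = 1 →
      (∀ j, j ∉ δ.E → coeff (Finsupp.single j 1) δ.f = 0) →
      DBWinsTo (fun τ => GermIsNC τ.1 ∨ (Admissible τ.1 τ.2 ∧ τ.2.head < δ.head)) (b, δ))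
    (b : MvPowerSeries (Fin (2 + 1)) k) (δ : Decoration k 2) (hadm : Admissible b δ) :
    DBWinsTo (fun τ : MvPowerSeries (Fin (2 + 1)) k × Decoration k 2 => GermIsNC τ.1) (b, δ) :=
  surfaceBoundaryNC_of_apexColumnB_of_endB p hH (endPhaseB_of_tangent hT) b δ hadm

end TameFourTupleDrop

end Summit.ResolutionOfSingularities.ResolutionOfSingularities.Theorems

end
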